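import Mathlib
import Summits.ValiantsHypothesis.ValiantsHypothesis.Theorems.GrenetZeonPolySizeQPAlgebraTaylorTwo
import Summits.ValiantsHypothesis.ValiantsHypothesis.Theorems.GrenetZeonPolySizeQPAlgebraSquareZeroBlock
import Summits.ValiantsHypothesis.ValiantsHypothesis.Theorems.GrenetZeonPolySizeQPAlgebraResidualCorankOne
import Summits.ValiantsHypothesis.ValiantsHypothesis.Theorems.GrenetZeonPolySizeQPAlgebraCorankTwoForms
import Summits.ValiantsHypothesis.ValiantsHypothesis.Theorems.GrenetZeonPolySizeQPAlgebraAdjugateLengthTwo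
import HarnessLib

/-!
# Crux `GrenetZeon.PolySizeQPAlgebra` (stmt-ValiantsHypothesis-8064), line `vbp-slice-dealg` —
# the local Hessian bound at a block normal form `A(p) = diag(1_κ, S)`, `S ∈ Mat₂`, `det S = 0`

Input (B) of the `c = 1` box (`…LocalReduction`, `…LocalReductionResidual`) is the type-independent bound
`rank Hess λ(det A)(p) ≤ 2 · dim R · n` at points with `det A(p) = 0` in the coefficient algebra `R`.
`…ResidualCorankOne` proves it wherever `A(p)` has a unimodular kernel vector.  This file proves it at
points where the value matrix IS the block normal form `diag(1_κ, S)` with `S` a singular `2 × 2` matrix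
over `R` — the normal form of residual corank `≤ 2` (the transport of an arbitrary `A(p)` with a unit
`(n-2)`-minor to this form is `…ResidualCorankTwo`).  Assembly of the hand 6-g2 programme FACT 0/1/2:

* `det_block_sqz_map` — the block formula `det_block_sqz` (`…SquareZeroBlock`) read through a ring map.
* `eval_pderiv_pderiv_det_blockNormalForm` — **FACT 0+1+2 as one identity in `R`**: for affine `A` with
  `A(x) = diag(1, S)`, `det S = 0`, and `X = ∂_s A(x)`, `Y = ∂_t A(x)` in blocks,
  `∂_s∂_t det A (x) = tr(adj X₂₂·Y₂₂) - tr(adj S·(X₂₁Y₁₂ + Y₂₁X₁₂)) + tr X₁₁·tr(adj S·Y₂₂) + tr Y₁₁·tr(adj S·X₂₂)`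
  (second-order Taylor in the jet ring `R[η][ε]`, `…TaylorTwo`, then `det_block_sqz`).
* `rank_hess0_transl_le_of_blockNormalForm` — **the bound `rank Hess F(p) ≤ 2 · dim R · (|κ| + 2)`** for
  `F = λ(det A)`, ANY finite-dimensional commutative `ℂ`-algebra `R` and any functional `λ`: the Hessian is
  `G - Σ_c H₃(c) - Σ_c H₄(c)` with `G` the symmetrised form of the graph lemma (`rank ≤ 4 dim R`,
  `…CorankTwoForms`) and `H₃(c)`, `H₄(c)` read-outs through `(adj S)ᵀ`, `adj S` (ranks `≤ ℓ Row`, `ℓ Col`),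
  closed by `AL(2)` for `adj S` (`…AdjugateLengthTwo`): `4 dim R + |κ| · 2 dim R`.

HONEST FRAMING: a rank count; no stub of the line is closed; VP ≠ VNP is not moved.

References: T. Mignon, N. Ressayre, IMRN 2004:79, §2 (the case `R = ℂ`) [MignonRessayre2004].
-/

noncomputable section

open MvPolynomial Matrix
open Literature.Computability.AlgebraicComplexity

-- single-conjunct layout `Summits/ValiantsHypothesis/ValiantsHypothesis`: duplicated namespace by design
set_option linter.dupNamespace false

namespace Summit.ValiantsHypothesis.ValiantsHypothesis.Theorems.GrenetZeonPolySizeQPAlgebra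

/-! ### The block formula read through a ring homomorphism -/

section BlockMap

variable {T R : Type*} [CommRing T] [CommRing R] {ε η : T} {κ : Type*} [Fintype κ] [DecidableEq κ]

/-- `det_block_sqz` for blocks that are images of matrices over `R` under a ring map `c : R → T`:
the coefficients of `ε`, `η`, `εη` are images of elements of `R`. [cite: MignonRessayre2004, §2] -/
theorem det_block_sqz_map (c : R →+* T) (hε : ε * ε = 0) (hη : η * η = 0)
    (S : Matrix (Fin 2) (Fin 2) R) (hS : S.det = 0) (X₁₁ Y₁₁ : Matrix κ κ R)
    (X₁₂ Y₁₂ : Matrix κ (Fin 2) R) (X₂₁ Y₂₁ : Matrix (Fin 2) κ R) (X₂₂ Y₂₂ : Matrix (Fin 2) (Fin 2) R) :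
    (Matrix.fromBlocks (1 + (ε • X₁₁.map c + η • Y₁₁.map c)) (ε • X₁₂.map c + η • Y₁₂.map c)
        (ε • X₂₁.map c + η • Y₂₁.map c) (S.map c + (ε • X₂₂.map c + η • Y₂₂.map c))).det =
      ε * c (S.adjugate * X₂₂).trace + η * c (S.adjugate * Y₂₂).trace +
        ε * η * c ((X₂₂.adjugate * Y₂₂).trace - (S.adjugate * (X₂₁ * Y₁₂ + Y₂₁ * X₁₂)).trace +
          X₁₁.trace * (S.adjugate * Y₂₂).trace + Y₁₁.trace * (S.adjugate * X₂₂).trace) := by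
  have hS' : (S.map c).det = 0 := by
    rw [← RingHom.mapMatrix_apply, ← RingHom.map_det, hS, map_zero]
  have hadj : ∀ N : Matrix (Fin 2) (Fin 2) R, (N.map c).adjugate = N.adjugate.map c := fun N => by
    rw [← RingHom.mapMatrix_apply, ← RingHom.map_adjugate, RingHom.mapMatrix_apply]
  have htr₂ : ∀ N : Matrix (Fin 2) (Fin 2) R, (N.map c).trace = c N.trace := fun N =>
    (AddMonoidHom.map_trace (c : R →+* T).toAddMonoidHom N).symm
  have htrκ : ∀ N : Matrix κ κ R, (N.map c).trace = c N.trace := fun N =>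
    (AddMonoidHom.map_trace (c : R →+* T).toAddMonoidHom N).symm
  have hmadd : ∀ M N : Matrix (Fin 2) (Fin 2) R, (M + N).map c = M.map c + N.map c := fun M N =>
    Matrix.map_add c (map_add c) M N
  rw [det_block_sqz hε hη (S.map c) hS']
  simp only [hadj, ← Matrix.map_mul, ← hmadd, htr₂, htrκ, ← map_mul, ← map_add, ← map_sub]

end BlockMap

/-! ### Second partials of an affine determinant at a block normal form -/

section JetBlock

variable {σ : Type*} [DecidableEq σ] {R : Type*} [CommRing R] {κ : Type*} [Fintype κ] [DecidableEq κ]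

/-- **`∂_s ∂_t det A (x)` at a point where `A(x) = diag(1_κ, S)`, `det S = 0`.**  With
`X = ∂_s A (x)`, `Y = ∂_t A (x)` in blocks, `τ = tr (·)₁₁`, `ζ = tr(adj S · (·)₂₂)`:
`∂_s ∂_t det A (x) = tr(adj X₂₂ · Y₂₂) - tr(adj S · (X₂₁ Y₁₂ + Y₂₁ X₁₂)) + τ(X) ζ(Y) + τ(Y) ζ(X)`
(the `εη`-coefficient of `det_block_sqz` in the jet ring `R[η][ε]`, `…TaylorTwo`).
[cite: MignonRessayre2004, §2] -/
theorem eval_pderiv_pderiv_det_blockNormalForm (x : σ → R) (s t : σ)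
    (A : Matrix (κ ⊕ Fin 2) (κ ⊕ Fin 2) (MvPolynomial σ R)) (hA : ∀ i j, (A i j).totalDegree ≤ 1)
    (S : Matrix (Fin 2) (Fin 2) R) (hB : A.map (eval x) = Matrix.fromBlocks 1 0 0 S) (hS : S.det = 0)
    (X Y : Matrix (κ ⊕ Fin 2) (κ ⊕ Fin 2) R) (hX : (A.map fun a => eval x (pderiv s a)) = X)
    (hY : (A.map fun a => eval x (pderiv t a)) = Y) :
    eval x (pderiv s (pderiv t A.det)) =
      (X.toBlocks₂₂.adjugate * Y.toBlocks₂₂).trace -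
          (S.adjugate * (X.toBlocks₂₁ * Y.toBlocks₁₂ + Y.toBlocks₂₁ * X.toBlocks₁₂)).trace +
        X.toBlocks₁₁.trace * (S.adjugate * Y.toBlocks₂₂).trace +
        Y.toBlocks₁₁.trace * (S.adjugate * X.toBlocks₂₂).trace := by
  rw [eval_pderiv_pderiv_det_eq_jet x s t A hA, hB, hX, hY]
  set c := algebraMap R (DualNumber (DualNumber R)) with hc
  set ε : DualNumber (DualNumber R) := DualNumber.eps with hε
  set η : DualNumber (DualNumber R) := algebraMap (DualNumber R) (DualNumber (DualNumber R))
    DualNumber.eps with hη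
  have hM : (Matrix.fromBlocks 1 0 0 S : Matrix _ _ R).map c + ε • X.map c + η • Y.map c =
      Matrix.fromBlocks (1 + (ε • X.toBlocks₁₁.map c + η • Y.toBlocks₁₁.map c))
        (ε • X.toBlocks₁₂.map c + η • Y.toBlocks₁₂.map c)
        (ε • X.toBlocks₂₁.map c + η • Y.toBlocks₂₁.map c)
        (S.map c + (ε • X.toBlocks₂₂.map c + η • Y.toBlocks₂₂.map c)) := by
    conv_lhs => rw [← Matrix.fromBlocks_toBlocks X, ← Matrix.fromBlocks_toBlocks Y]
    rw [Matrix.fromBlocks_map, Matrix.fromBlocks_map, Matrix.fromBlocks_map, Matrix.fromBlocks_smul,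
      Matrix.fromBlocks_smul, Matrix.fromBlocks_add, Matrix.fromBlocks_add,
      Matrix.map_one c (map_zero c) (map_one c), Matrix.map_zero c (map_zero c),
      Matrix.map_zero c (map_zero c), zero_add, zero_add, add_assoc, add_assoc]
  rw [hM]
  have h := det_block_sqz_map c (ε := ε) (η := η) eps_mul_eps_jet eta_mul_eta_jet S hS
    X.toBlocks₁₁ Y.toBlocks₁₁ X.toBlocks₁₂ Y.toBlocks₁₂ X.toBlocks₂₁ Y.toBlocks₂₁ X.toBlocks₂₂ Y.toBlocks₂₂
  have h' : (Matrix.fromBlocks (1 + (ε • X.toBlocks₁₁.map c + η • Y.toBlocks₁₁.map c))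
        (ε • X.toBlocks₁₂.map c + η • Y.toBlocks₁₂.map c)
        (ε • X.toBlocks₂₁.map c + η • Y.toBlocks₂₁.map c)
        (S.map c + (ε • X.toBlocks₂₂.map c + η • Y.toBlocks₂₂.map c))).det =
      ε * c (S.adjugate * X.toBlocks₂₂).trace + η * c (S.adjugate * Y.toBlocks₂₂).trace +
        ε * η * c ((X.toBlocks₂₂.adjugate * Y.toBlocks₂₂).trace -
          (S.adjugate * (X.toBlocks₂₁ * Y.toBlocks₁₂ + Y.toBlocks₂₁ * X.toBlocks₁₂)).trace +
          X.toBlocks₁₁.trace * (S.adjugate * Y.toBlocks₂₂).trace +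
          Y.toBlocks₁₁.trace * (S.adjugate * X.toBlocks₂₂).trace) := h
  rw [h']
  simp only [TrivSqZeroExt.snd_add, snd_snd_mul, fst_fst_mul, fst_snd_mul, snd_fst_mul,
    eps_jet_components, eta_jet_components, algebraMap_jet_components, hc, hε, hη]
  ring

end JetBlock

/-! ### The Hessian of a read-out at a block normal form and its rank -/

section Rank

variable {R : Type*} [CommRing R]

/-- `tr(M · P · Q) = Σ_c (Q_{c•}) · (M (P_{•c}))`: the trace of a product through a `κ`-indexed middle
factor as a sum of `κ` bilinear read-outs. [folklore] -/
theorem trace_mul_mul_eq_sum_dotProduct {κ : Type*} [Fintype κ] {m : Type*} [Fintype m]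
    (M : Matrix m m R) (P : Matrix m κ R) (Q : Matrix κ m R) :
    (M * (P * Q)).trace = ∑ c, (fun a => Q c a) ⬝ᵥ (M *ᵥ fun b => P b c) := by
  calc (M * (P * Q)).trace = ∑ a, ∑ b, ∑ c, M a b * P b c * Q c a := by
        simp only [Matrix.trace, Matrix.diag, Matrix.mul_apply, Finset.mul_sum, mul_assoc]
    _ = ∑ a, ∑ c, ∑ b, M a b * P b c * Q c a := Finset.sum_congr rfl fun a _ => Finset.sum_comm
    _ = ∑ c, ∑ a, ∑ b, M a b * P b c * Q c a := Finset.sum_comm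
    _ = ∑ c, (fun a => Q c a) ⬝ᵥ (M *ᵥ fun b => P b c) := by
        refine Finset.sum_congr rfl fun c _ => ?_
        simp only [dotProduct, Matrix.mulVec, Finset.mul_sum]
        refine Finset.sum_congr rfl fun a _ => Finset.sum_congr rfl fun b _ => ?_
        ring

/-- `u · (M v) = v · (Mᵀ u)`. [folklore] -/
theorem dotProduct_mulVec_eq_dotProduct_transpose_mulVec {m : Type*} [Fintype m] (u v : m → R)
    (M : Matrix m m R) : u ⬝ᵥ (M *ᵥ v) = v ⬝ᵥ (Mᵀ *ᵥ u) := by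
  rw [Matrix.dotProduct_mulVec, ← Matrix.mulVec_transpose, dotProduct_comm]

variable [Algebra ℂ R] [Module.Finite ℂ R]

omit [Module.Finite ℂ R] in
/-- Rank is invariant under negation. [folklore] -/
theorem rank_neg_eq {m n : Type*} [Fintype m] [Fintype n] (M : Matrix m n ℂ) : (-M).rank = M.rank := by
  unfold Matrix.rank
  have h : (-M).mulVecLin = -M.mulVecLin := by
    apply LinearMap.ext
    intro v
    simp
  rw [h, LinearMap.range_neg]

variable {σ : Type*} [Fintype σ] [DecidableEq σ] {κ : Type*} [Fintype κ] [DecidableEq κ]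

/-- **Local Hessian bound at a block normal form of residual corank two.**  Let `R` be any
finite-dimensional commutative `ℂ`-algebra, `λ : R → ℂ` linear, `A` a square matrix of affine forms over
`R` indexed by `κ ⊕ Fin 2` whose value at the point `p` is `diag(1_κ, S)` with `det S = 0`, and
`F = λ(det A)` coefficientwise.  Then `rank Hess F(p) ≤ 2 · dim R · (|κ| + 2)`: by
`eval_pderiv_pderiv_det_blockNormalForm` the Hessian is `G - Σ_c H₃(c) - Σ_c H₄(c)` with `G` the
symmetrised `2 × 2` form of the graph lemma (`rank ≤ 4 dim R`, `…CorankTwoForms`) and `H₃(c)`, `H₄(c)`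
bilinear read-outs through `adj S` and `(adj S)ᵀ` (`rank ≤ ℓ Col`, `ℓ Row`), and
`ℓ Col(adj S) + ℓ Row(adj S) ≤ 2 dim R` (`AL(2)`, `…AdjugateLengthTwo`). [cite: MignonRessayre2004, §2] -/
theorem rank_hess0_transl_le_of_blockNormalForm (l : R →ₗ[ℂ] ℂ)
    (A : Matrix (κ ⊕ Fin 2) (κ ⊕ Fin 2) (MvPolynomial σ R)) (F : MvPolynomial σ ℂ)
    (hA : ∀ a b, (A a b).totalDegree ≤ 1) (hF : ∀ d, l (coeff d A.det) = coeff d F)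
    (p : σ → ℂ) (S : Matrix (Fin 2) (Fin 2) R)
    (hB : A.map (eval fun i => algebraMap ℂ R (p i)) = Matrix.fromBlocks 1 0 0 S) (hS : S.det = 0) :
    (hess0 (transl p F)).rank ≤ 2 * Module.finrank ℂ R * (Fintype.card κ + 2) := by
  classical
  set x : σ → R := fun i => algebraMap ℂ R (p i) with hx
  set Xf : σ → Matrix (κ ⊕ Fin 2) (κ ⊕ Fin 2) R := fun s => A.map fun a => eval x (pderiv s a)
    with hXf
  -- the entries of the Hessian
  have hE : ∀ s t, hess0 (transl p F) s t =
      l (((Xf s).toBlocks₂₂.adjugate * (Xf t).toBlocks₂₂).trace -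
          (S.adjugate * ((Xf s).toBlocks₂₁ * (Xf t).toBlocks₁₂ +
            (Xf t).toBlocks₂₁ * (Xf s).toBlocks₁₂)).trace +
        (Xf s).toBlocks₁₁.trace * (S.adjugate * (Xf t).toBlocks₂₂).trace +
        (Xf t).toBlocks₁₁.trace * (S.adjugate * (Xf s).toBlocks₂₂).trace) := by
    intro s t
    rw [hess0_transl_readOut l hF p s t,
      eval_pderiv_pderiv_det_blockNormalForm x s t A hA S hB hS (Xf s) (Xf t) rfl rfl]
  -- the three pieces
  set τ : σ → R := fun s => (Xf s).toBlocks₁₁.trace with hτ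
  set Z : σ → Matrix (Fin 2) (Fin 2) R := fun s => (Xf s).toBlocks₂₂ with hZ
  set G : Matrix σ σ ℂ := Matrix.of fun s t => l (τ s * (S.adjugate * Z t).trace +
    τ t * (S.adjugate * Z s).trace + ((Z s).adjugate * Z t).trace) with hG
  set H₃ : κ → Matrix σ σ ℂ := fun c => Matrix.of fun s t =>
    l ((fun b => (Xf s).toBlocks₂₁ b c) ⬝ᵥ (S.adjugateᵀ *ᵥ fun a => (Xf t).toBlocks₁₂ c a)) with hH₃
  set H₄ : κ → Matrix σ σ ℂ := fun c => Matrix.of fun s t =>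
    l ((fun a => (Xf s).toBlocks₁₂ c a) ⬝ᵥ (S.adjugate *ᵥ fun b => (Xf t).toBlocks₂₁ b c)) with hH₄
  have hH : hess0 (transl p F) = G + -(∑ c, H₃ c) + -(∑ c, H₄ c) := by
    ext s t
    rw [hE s t, Matrix.add_apply, Matrix.add_apply, Matrix.neg_apply, Matrix.neg_apply,
      Matrix.sum_apply, Matrix.sum_apply]
    simp only [hG, hH₃, hH₄, Matrix.of_apply, hτ, hZ]
    rw [Matrix.mul_add, Matrix.trace_add, trace_mul_mul_eq_sum_dotProduct,
      trace_mul_mul_eq_sum_dotProduct, ← map_sum, ← map_sum]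
    simp only [dotProduct_mulVec_eq_dotProduct_transpose_mulVec (fun a => (Xf t).toBlocks₁₂ _ a)]
    rw [← map_neg, ← map_neg, ← map_add, ← map_add]
    congr 1
    ring
  -- ranks of the pieces
  have hGr : G.rank ≤ 4 * Module.finrank ℂ R := rank_symmetrised_fin_two_form_le l S hS τ Z
  have hadjdet : S.adjugate.det = 0 := by
    rw [Matrix.det_adjugate, hS, Fintype.card_fin]
    norm_num
  have hAL := finrank_range_mulVecLin_add_le_of_det_eq_zero S.adjugate hadjdet
  have h3 : ∀ c, (H₃ c).rank ≤
      Module.finrank ℂ (LinearMap.range (S.adjugateᵀ.mulVecLin.restrictScalars ℂ)) := fun c =>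
    rank_dotProduct_mulVec_readOut_le l S.adjugateᵀ _ _
  have h4 : ∀ c, (H₄ c).rank ≤
      Module.finrank ℂ (LinearMap.range (S.adjugate.mulVecLin.restrictScalars ℂ)) := fun c =>
    rank_dotProduct_mulVec_readOut_le l S.adjugate _ _
  have h3s : (∑ c, H₃ c).rank ≤ Fintype.card κ *
      Module.finrank ℂ (LinearMap.range (S.adjugateᵀ.mulVecLin.restrictScalars ℂ)) := by
    refine (rank_sum_le _ _).trans ?_
    calc ∑ c, (H₃ c).rank ≤ ∑ _c : κ,
        Module.finrank ℂ (LinearMap.range (S.adjugateᵀ.mulVecLin.restrictScalars ℂ)) :=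
          Finset.sum_le_sum fun c _ => h3 c
      _ = _ := by rw [Finset.sum_const, Finset.card_univ, smul_eq_mul]
  have h4s : (∑ c, H₄ c).rank ≤ Fintype.card κ *
      Module.finrank ℂ (LinearMap.range (S.adjugate.mulVecLin.restrictScalars ℂ)) := by
    refine (rank_sum_le _ _).trans ?_
    calc ∑ c, (H₄ c).rank ≤ ∑ _c : κ,
        Module.finrank ℂ (LinearMap.range (S.adjugate.mulVecLin.restrictScalars ℂ)) :=
          Finset.sum_le_sum fun c _ => h4 c
      _ = _ := by rw [Finset.sum_const, Finset.card_univ, smul_eq_mul]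
  rw [hH]
  refine (rank_add_le _ _).trans ?_
  refine (Nat.add_le_add (rank_add_le _ _) le_rfl).trans ?_
  rw [rank_neg_eq, rank_neg_eq]
  have hk : Fintype.card κ *
      (Module.finrank ℂ (LinearMap.range (S.adjugate.mulVecLin.restrictScalars ℂ)) +
        Module.finrank ℂ (LinearMap.range (S.adjugateᵀ.mulVecLin.restrictScalars ℂ))) ≤
      Fintype.card κ * (2 * Module.finrank ℂ R) := Nat.mul_le_mul_left _ hAL
  nlinarith [hGr, h3s, h4s, hk]

end Rank

end Summit.ValiantsHypothesis.ValiantsHypothesis.Theorems.GrenetZeonPolySizeQPAlgebra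

end
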